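import Summits.MatrixMultiplication.MatrixMultiplication.Theorems.SoloBlindLeviCivitaCubeFlattening
import Literature.Analysis.Matrix.KroneckerSumExp

/-!
# SoloBlindIdenticalSlotObstruction — the determinant-line identity

solo `solo-MatrixMultiplication-blind`; evidence file
`run/shared/lean/ideation/MatrixMultiplication/solo-blind/paper/paper.md`, §17.14 (I)
(Koszul-flattening saturation of Kronecker powers — a CONSEQUENCE-side study; no bearing on `ω = 2` is
claimed).

What is proved here, for an arbitrary commutative ring `R` and the Levi-Civita tensor `lcTensor R`
(entries `leviCivita3Table`, from `SoloBlindLeviCivitaCubeFlattening`) viewed as a vector on the index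
type `(Fin 3 × Fin 3) × Fin 3` of a Kronecker cube:

* `soloKoszul_cube_mulVec_leviCivita` : `(A ⊗ₖ A ⊗ₖ A) *ᵥ ε = det A • ε`
  (the Kronecker cube of a `3 × 3` matrix acts on the determinant line by the determinant);
* `soloKoszul_commutator_on_detLine` : for letters `X_b = Z_b^{⊗3} ⊗ X'_b`, `X_c = Z_c^{⊗3} ⊗ X'_c` the
  commutator `X_b X_c − X_c X_b` maps `ε ⊗ w` to `(det Z_b · det Z_c) · (ε ⊗ [X'_b, X'_c] w)`.

INFORMAL CONTEXT (not formalised in this file): in the evidence file these two identities are the whole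
content of an "identical-slot obstruction" — if three tensor slots of a tuple of Kronecker-product letters
carry identical invertible `3 × 3` factors `Z_b`, the Koszul flattening built from the commutators,
restricted to `Λ^•V ⊗ ε ⊗ W'`, is the complementary flattening with rows rescaled by `det Z_b · det Z_c`,
so its kernel contains a rescaled copy of the complementary kernel.  That consequence (a statement about
kernels of flattenings) is NOT proved here; only the pointwise identities are.
Standard axioms; no new definitions.
-/

namespace Summit.MatrixMultiplication.MatrixMultiplication.Theorems

open Matrix
open scoped Kronecker
open Literature.Computability.AlgebraicComplexity (leviCivita3Table)
open Literature.Analysis.Matrix.KroneckerSum (kronecker_mulVec_tensor)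

section

variable {R : Type*} [CommRing R]

/-- The Kronecker cube of a `3 × 3` matrix acts on the Levi-Civita tensor (the determinant line `Λ³`)
by the determinant: `(A ⊗ₖ A ⊗ₖ A) ε = det A • ε`. -/
theorem soloKoszul_cube_mulVec_leviCivita (A : Matrix (Fin 3) (Fin 3) R) :
    (A ⊗ₖ A ⊗ₖ A) *ᵥ (fun p : (Fin 3 × Fin 3) × Fin 3 => lcTensor R p.1.1 p.1.2 p.2)
      = A.det • (fun p : (Fin 3 × Fin 3) × Fin 3 => lcTensor R p.1.1 p.1.2 p.2) := by
  ext ⟨⟨i, j⟩, k⟩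
  simp only [mulVec, dotProduct, Fintype.sum_prod_type, Fin.sum_univ_three, kroneckerMap_apply,
    Pi.smul_apply, smul_eq_mul, det_fin_three, lcTensor_apply, leviCivita3Table]
  fin_cases i <;> fin_cases j <;> fin_cases k <;> simp <;> ring

/-- Mixed-product rule for letters of the form `Z^{⊗3} ⊗ X`. -/
theorem soloKoszul_cubeKron_mul {n : Type*} [Fintype n]
    (Z Z' : Matrix (Fin 3) (Fin 3) R) (X X' : Matrix n n R) :
    ((Z ⊗ₖ Z ⊗ₖ Z) ⊗ₖ X) * ((Z' ⊗ₖ Z' ⊗ₖ Z') ⊗ₖ X')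
      = ((Z * Z') ⊗ₖ (Z * Z') ⊗ₖ (Z * Z')) ⊗ₖ (X * X') := by
  simp [← mul_kronecker_mul]

/-- The commutator identity on any common eigenline of the cubes: if every Kronecker cube acts on `v` by
the determinant, then `[Z_b^{⊗3} ⊗ X'_b, Z_c^{⊗3} ⊗ X'_c] (v ⊗ w) = (det Z_b det Z_c) · v ⊗ ([X'_b, X'_c] w)`.
(Product vectors under Kronecker products: `kronecker_mulVec_tensor` of
`Literature.Analysis.Matrix.KroneckerSumExp`.) -/
theorem soloKoszul_commutator_on_eigenline {n : Type*} [Fintype n]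
    (Zb Zc : Matrix (Fin 3) (Fin 3) R) (Xb Xc : Matrix n n R)
    (v : (Fin 3 × Fin 3) × Fin 3 → R) (w : n → R)
    (hv : ∀ A : Matrix (Fin 3) (Fin 3) R, (A ⊗ₖ A ⊗ₖ A) *ᵥ v = A.det • v) :
    (((Zb ⊗ₖ Zb ⊗ₖ Zb) ⊗ₖ Xb) * ((Zc ⊗ₖ Zc ⊗ₖ Zc) ⊗ₖ Xc)
        - ((Zc ⊗ₖ Zc ⊗ₖ Zc) ⊗ₖ Xc) * ((Zb ⊗ₖ Zb ⊗ₖ Zb) ⊗ₖ Xb)) *ᵥ (fun q => v q.1 * w q.2)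
      = fun q => (Zb.det * Zc.det) * (v q.1 * ((Xb * Xc - Xc * Xb) *ᵥ w) q.2) := by
  rw [soloKoszul_cubeKron_mul, soloKoszul_cubeKron_mul, sub_mulVec,
    kronecker_mulVec_tensor, kronecker_mulVec_tensor, hv, hv, det_mul, det_mul]
  ext q
  simp only [Pi.sub_apply, Pi.smul_apply, smul_eq_mul, sub_mulVec]
  ring

/-- The identity on the determinant line of three identical slots: the commutator of
`X_b = Z_b^{⊗3} ⊗ X'_b` and `X_c = Z_c^{⊗3} ⊗ X'_c` is `det Z_b · det Z_c` times the complementary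
commutator, `[X_b, X_c] (ε ⊗ w) = (det Z_b det Z_c) · ε ⊗ ([X'_b, X'_c] w)`, with `ε = lcTensor R`.
(The kernel-of-flattening consequence described in the module docstring is informal and not proved here.) -/
theorem soloKoszul_commutator_on_detLine {n : Type*} [Fintype n]
    (Zb Zc : Matrix (Fin 3) (Fin 3) R) (Xb Xc : Matrix n n R) (w : n → R) :
    (((Zb ⊗ₖ Zb ⊗ₖ Zb) ⊗ₖ Xb) * ((Zc ⊗ₖ Zc ⊗ₖ Zc) ⊗ₖ Xc)
        - ((Zc ⊗ₖ Zc ⊗ₖ Zc) ⊗ₖ Xc) * ((Zb ⊗ₖ Zb ⊗ₖ Zb) ⊗ₖ Xb))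
          *ᵥ (fun q => lcTensor R q.1.1.1 q.1.1.2 q.1.2 * w q.2)
      = fun q => (Zb.det * Zc.det) * (lcTensor R q.1.1.1 q.1.1.2 q.1.2 * ((Xb * Xc - Xc * Xb) *ᵥ w) q.2) :=
  soloKoszul_commutator_on_eigenline Zb Zc Xb Xc
    (fun p : (Fin 3 × Fin 3) × Fin 3 => lcTensor R p.1.1 p.1.2 p.2) w
    (fun A => soloKoszul_cube_mulVec_leviCivita A)

end

end Summit.MatrixMultiplication.MatrixMultiplication.Theorems
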